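import Literature.NumberTheory.Sieve.HeathBrownIdentity
import HarnessLib

/-!
# Heath-Brown's identity for the Möbius function

Topic `Literature/NumberTheory/Sieve`; theorems only, everything PROVED.  Companion of
`Literature.NumberTheory.Sieve.HeathBrownIdentity` (the identity for `Λ`, `heathBrown_identity`): the Möbius
version, for `K ≥ 1`, `z ≥ 0` and `n ≤ z^K`,

`μ(n) = ∑_{j=1}^{K} (−1)^{j+1} (K choose j) (μ_{≤z}^{⋆j} ⋆ ζ^{⋆(j−1)})(n)`,

with the same proof as the `Λ` case (the base file's `defect_pow_apply_eq_zero_real`), `ζ ⋆ μ = δ` replacing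
`Λ ⋆ ζ = log` (D. R. Heath-Brown, *Prime numbers in short intervals and a generalized Vaughan identity*,
Canad. J. Math. 34 (1982), Lemma 1, stated there for `Λ`; the `μ` form is the standard variant, e.g.
Iwaniec–Kowalski §13.3).  Written by planner-cruxplan-stmt-Parity-14272-peel-to-drappeau-g2-0 as evidence for the
crux `TypeI2Dilated` (line `peel-to-drappeau`, stub `stub_uRBound`), landed by the line lead.

## References

* D. R. Heath-Brown, Canad. J. Math. 34 (1982), 1365–1377, Lemma 1. [Heathbrown1982]
-/

open Finset Nat
open scoped ArithmeticFunction.Moebius ArithmeticFunction.zeta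

namespace Literature.NumberTheory.Sieve

namespace HeathBrown

/-- The `j`-th Heath-Brown term for `μ`: `(μ_{≤U} ⋆ ζ)^{⋆j} ⋆ μ = μ_{≤U}^{⋆j} ⋆ ζ^{⋆(j−1)}` for
`j ≥ 1` (from `ζ ⋆ μ = δ`, Mathlib's `coe_zeta_mul_coe_moebius`). [folklore] -/
theorem term_eq_moebius (U : ℕ) {j : ℕ} (hj : 1 ≤ j) :
    ((moebiusTrunc U : ArithmeticFunction ℝ) * (ζ : ArithmeticFunction ℝ)) ^ j *
        (μ : ArithmeticFunction ℝ) =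
      (moebiusTrunc U : ArithmeticFunction ℝ) ^ j * (ζ : ArithmeticFunction ℝ) ^ (j - 1) := by
  obtain ⟨i, rfl⟩ := Nat.exists_eq_add_of_le' hj
  rw [Nat.add_sub_cancel, mul_pow, pow_succ]
  calc (moebiusTrunc U : ArithmeticFunction ℝ) ^ (i + 1) *
          ((ζ : ArithmeticFunction ℝ) ^ i * (ζ : ArithmeticFunction ℝ)) * (μ : ArithmeticFunction ℝ)
        = (moebiusTrunc U : ArithmeticFunction ℝ) ^ (i + 1) * (ζ : ArithmeticFunction ℝ) ^ i *
            ((ζ : ArithmeticFunction ℝ) * (μ : ArithmeticFunction ℝ)) := by ring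
    _ = (moebiusTrunc U : ArithmeticFunction ℝ) ^ (i + 1) * (ζ : ArithmeticFunction ℝ) ^ i := by
          rw [ArithmeticFunction.coe_zeta_mul_coe_moebius, mul_one]

end HeathBrown

open HeathBrown in
/-- **Heath-Brown's identity for `μ`.**  Let `K ≥ 1`, `z ≥ 0` real, `μ_{≤z} = moebiusTrunc ⌊z⌋₊`.  Then for
every natural number `n ≤ z^K`,
`μ(n) = ∑_{j=1}^{K} (−1)^{j+1} (K choose j) (μ_{≤z}^{⋆j} ⋆ ζ^{⋆(j−1)})(n)`,
i.e. `μ(n) = ∑_{j=1}^K (−1)^{j−1} (K choose j) ∑_{m₁⋯m_j n₁⋯n_{j−1} = n, mᵢ ≤ z} μ(m₁)⋯μ(m_j)`.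
Proof: `E = δ − μ_{≤z} ⋆ ζ` vanishes on `[1, z]`, so `E^{⋆K} ⋆ μ` vanishes on `[1, z^K]`; expand binomially
and use `ζ ⋆ μ = δ`. [cite: Heathbrown1982, Lemma 1] -/
theorem heathBrown_identity_moebius {K : ℕ} (hK : 1 ≤ K) {z : ℝ} (hz : 0 ≤ z) {n : ℕ}
    (hn : (n : ℝ) ≤ z ^ K) :
    (μ n : ℝ) = ∑ j ∈ Icc 1 K, (-1 : ℝ) ^ (j + 1) * (K.choose j : ℝ) *
      ((moebiusTrunc ⌊z⌋₊ : ArithmeticFunction ℝ) ^ j * (ζ : ArithmeticFunction ℝ) ^ (j - 1)) n := by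
  set M : ArithmeticFunction ℝ := (moebiusTrunc ⌊z⌋₊ : ArithmeticFunction ℝ) with hM
  set Z : ArithmeticFunction ℝ := (ζ : ArithmeticFunction ℝ) with hZ
  -- `E^K ⋆ μ` vanishes at `n`: every divisor `d` of `n` has `d ≤ n ≤ z^K`
  have hvanish : ((1 - M * Z) ^ K * (μ : ArithmeticFunction ℝ)) n = 0 := by
    rw [ArithmeticFunction.mul_apply]
    refine Finset.sum_eq_zero fun p hp => ?_
    rw [Nat.mem_divisorsAntidiagonal] at hp
    have hp1 : p.1 ≤ n := Nat.le_of_dvd (Nat.pos_of_ne_zero hp.2) ⟨p.2, hp.1.symm⟩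
    rw [defect_pow_apply_eq_zero_real hz hK ((Nat.cast_le.mpr hp1).trans hn), zero_mul]
  -- binomial expansion of `(1 - M Z)^K = ((-1) (M Z) + 1)^K`
  have hexp : (1 - M * Z) ^ K =
      ∑ j ∈ range (K + 1), (K.choose j : ArithmeticFunction ℝ) * ((-1) ^ j * (M * Z) ^ j) := by
    rw [show (1 - M * Z) = (-1) * (M * Z) + 1 by ring, add_pow]
    refine Finset.sum_congr rfl fun j _ => ?_
    rw [one_pow, mul_one, mul_pow]
    ring
  rw [hexp, Finset.sum_mul, finset_sum_apply, Finset.sum_range_succ', Nat.choose_zero_right,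
    Nat.cast_one, one_mul, pow_zero, pow_zero, one_mul, one_mul,
    ArithmeticFunction.intCoe_apply] at hvanish
  -- `hvanish : ∑_{j < K} (choose K (j+1) * ((-1)^(j+1) * (MZ)^(j+1)) * μ) n + μ n = 0`
  have hterm : ∀ j ∈ range K,
      ((K.choose (j + 1) : ArithmeticFunction ℝ) * ((-1) ^ (j + 1) * (M * Z) ^ (j + 1)) *
          (μ : ArithmeticFunction ℝ)) n =
        -((-1 : ℝ) ^ (j + 1 + 1) * (K.choose (j + 1) : ℝ) *
          (M ^ (j + 1) * Z ^ (j + 1 - 1)) n) := by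
    intro j _
    rw [mul_assoc, natCast_mul_apply, mul_assoc, neg_one_pow_mul_apply,
      term_eq_moebius ⌊z⌋₊ (Nat.le_add_left 1 j), pow_succ (-1 : ℝ) (j + 1)]
    ring
  rw [Finset.sum_congr rfl hterm, Finset.sum_neg_distrib] at hvanish
  -- reindex `Icc 1 K` as `1 + j`, `j ∈ range K`
  rw [← Finset.Ico_add_one_right_eq_Icc, Finset.sum_Ico_eq_sum_range, Nat.add_sub_cancel]
  simp_rw [add_comm 1]
  linarith

open HeathBrown in
/-- **Heath-Brown's identity for `μ`, natural truncation point.** For `K ≥ 1`, `U : ℕ` and `n ≤ U^K`: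
`μ(n) = ∑_{j=1}^{K} (−1)^{j+1} (K choose j) (μ_{≤U}^{⋆j} ⋆ ζ^{⋆(j−1)})(n)`. [cite: Heathbrown1982, Lemma 1] -/
theorem heathBrown_identity_moebius_nat {K : ℕ} (hK : 1 ≤ K) (U : ℕ) {n : ℕ} (hn : n ≤ U ^ K) :
    (μ n : ℝ) = ∑ j ∈ Icc 1 K, (-1 : ℝ) ^ (j + 1) * (K.choose j : ℝ) *
      ((moebiusTrunc U : ArithmeticFunction ℝ) ^ j * (ζ : ArithmeticFunction ℝ) ^ (j - 1)) n := by
  have h := heathBrown_identity_moebius hK (Nat.cast_nonneg U) (n := n) (by exact_mod_cast hn)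
  rwa [Nat.floor_natCast] at h

end Literature.NumberTheory.Sieve
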